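import Summits.KontsevichZagierPeriods.KontsevichZagierPeriods.Theorems.LinRedNormalFormArrangementNormalFormStubSeparateZeroPieceBound
import Summits.KontsevichZagierPeriods.KontsevichZagierPeriods.Theorems.LinRedNormalFormArrangementNormalFormStubSeparateZeroMarginals

/-!
# Stub `stub_separateZero` (crux `ArrangementNormalForm`, line `janus-bands`) — part `Poles`

The rational part `R(y) = P(y)/Q(y)` of a `JJ 1 k` integrand: the numerator as a one-variable
polynomial, the rows `αⱼ y + βⱼ` of the denominator (roots, multiplicities, the constant `κ` with
`Q = κ ∏ (y − rootⱼ)^{dⱼ}`), the null pole hyperplanes, and DOMINATION AT A POLE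
(`integrableOn_pole_mul_LB`): `(y − μ)^{-n}·LB` is integrable for `n ≤ E μ − min(ρ_μ, E μ)`
(`ρ_μ` the order of vanishing of the numerator), since `|y − μ|^{-(E−ρ)} ≤ C |R(y)|` near `μ`.
-/

noncomputable section

open Set MeasureTheory Polynomial
open Literature.NumberTheory.Transcendental
open scoped ENNReal

namespace Summit.KontsevichZagierPeriods.ArrangementNormalForm.JanusBands

namespace SepZero

variable {k m : ℕ}

/-! ### One-variable polynomial of the numerator -/

/-- The numerator `p : MvPolynomial (Fin 1) ℚ` as a one-variable polynomial. -/
def toPoly (p : MvPolynomial (Fin 1) ℚ) : ℚ[X] := MvPolynomial.aeval (fun _ => Polynomial.X) p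

/-- Evaluation of `toPoly p`. -/
theorem aeval_toPoly (p : MvPolynomial (Fin 1) ℚ) (y : ℝ) :
    Polynomial.aeval y (toPoly p) = MvPolynomial.aeval (fun _ => y) p := by
  unfold toPoly
  rw [← AlgHom.comp_apply, MvPolynomial.comp_aeval]
  simp

/-! ### Rows of the denominator -/

/-- The root `-β/α` of a row `α y + β`. -/
def root (c : Atom) : ℚ := -c.2 / c.1 0

/-- Initial multiplicities: `e j` for a genuine `y`-row, `0` for a constant row. -/
def dz (L : Fin m → Atom) (e : Fin m → ℕ) (j : Fin m) : ℕ := if (L j).1 0 = 0 then 0 else e j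

/-- The constant factor of a row. -/
def kfac (L : Fin m → Atom) (e : Fin m → ℕ) (j : Fin m) : ℚ :=
  if (L j).1 0 = 0 then (L j).2 ^ e j else (L j).1 0 ^ e j

/-- The constant `κ` with `Q(y) = κ ∏ⱼ (y − rootⱼ)^{dⱼ}`. -/
def kap (L : Fin m → Atom) (e : Fin m → ℕ) : ℚ := ∏ j, kfac L e j

/-- The denominator `Q(y) = ∏ⱼ (αⱼ y + βⱼ)^{eⱼ}`. -/
def Qf (L : Fin m → Atom) (e : Fin m → ℕ) (y : ℝ) : ℝ := ∏ j, (((L j).1 0 : ℝ) * y + (L j).2) ^ e j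

/-- The multiplicity of the pole value `μ`: `E μ = ∑_{root j = μ} dⱼ`. -/
def Emul (L : Fin m → Atom) (e : Fin m → ℕ) (μ : ℚ) : ℕ :=
  ∑ j ∈ Finset.univ.filter (fun j => root (L j) = μ), dz L e j

/-- Row-wise factorisation `(α y + β)^e = kfac · (y − root)^{dz}`. -/
theorem row_eq (L : Fin m → Atom) (e : Fin m → ℕ) (j : Fin m) (y : ℝ) :
    (((L j).1 0 : ℝ) * y + (L j).2) ^ e j = (kfac L e j : ℝ) * (y - root (L j)) ^ dz L e j := by
  unfold kfac dz root
  split_ifs with h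
  · simp [h]
  · have hα : ((L j).1 0 : ℝ) ≠ 0 := by exact_mod_cast h
    push_cast
    rw [← mul_pow]
    congr 1
    field_simp
    ring

/-- `Q(y) = κ ∏ⱼ (y − rootⱼ)^{dⱼ}`. -/
theorem Qf_eq (L : Fin m → Atom) (e : Fin m → ℕ) (y : ℝ) :
    Qf L e y = (kap L e : ℝ) * ∏ j, (y - root (L j)) ^ dz L e j := by
  unfold Qf kap
  push_cast
  rw [← Finset.prod_mul_distrib]
  exact Finset.prod_congr rfl fun j _ => row_eq L e j y

/-- Splitting off the pole value `μ`: `∏ⱼ (y − rootⱼ)^{dⱼ} = (y − μ)^{E μ} · ∏_{root ≠ μ}`. -/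
theorem prod_root_eq (L : Fin m → Atom) (e : Fin m → ℕ) (μ : ℚ) (y : ℝ) :
    ∏ j, (y - root (L j)) ^ dz L e j = (y - μ) ^ Emul L e μ *
      ∏ j ∈ Finset.univ.filter (fun j => root (L j) ≠ μ), (y - root (L j)) ^ dz L e j := by
  classical
  rw [← Finset.prod_filter_mul_prod_filter_not Finset.univ (fun j => root (L j) = μ)]
  congr 1
  rw [Emul, ← Finset.prod_pow_eq_pow_sum]
  refine Finset.prod_congr rfl fun j hj => ?_
  rw [(Finset.mem_filter.1 hj).2]

/-- Nondegeneracy of the rows: no row `0·y + 0` with positive exponent. -/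
def RowsOK (L : Fin m → Atom) (e : Fin m → ℕ) : Prop := ∀ j, (L j).1 0 = 0 → (L j).2 = 0 → e j = 0

/-- `κ ≠ 0` for nondegenerate rows. -/
theorem kap_ne_zero {L : Fin m → Atom} {e : Fin m → ℕ} (h : RowsOK L e) : kap L e ≠ 0 := by
  unfold kap kfac
  refine Finset.prod_ne_zero_iff.2 fun j _ => ?_
  split_ifs with hα
  · by_cases hβ : (L j).2 = 0
    · rw [h j hα hβ, pow_zero]; exact one_ne_zero
    · exact pow_ne_zero _ hβ
  · exact pow_ne_zero _ hα

/-- Off the roots of the genuine rows, `∏ⱼ (y − rootⱼ)^{dⱼ} ≠ 0`. -/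
theorem prod_root_ne_zero (L : Fin m → Atom) (e : Fin m → ℕ) {y : ℝ}
    (hy : ∀ j, (L j).1 0 ≠ 0 → y ≠ root (L j)) : ∏ j, (y - root (L j)) ^ dz L e j ≠ 0 := by
  refine Finset.prod_ne_zero_iff.2 fun j _ => ?_
  unfold dz
  split_ifs with hα
  · simp
  · exact pow_ne_zero _ (sub_ne_zero.2 (hy j hα))

/-- A bound for `|∏_{j ∈ T} (y − rootⱼ)^{dⱼ}|` on `|y| ≤ Lb`. -/
theorem abs_prod_root_le (L : Fin m → Atom) (e : Fin m → ℕ) (T : Finset (Fin m)) {y Lb : ℝ}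
    (hy : |y| ≤ Lb) : |∏ j ∈ T, (y - root (L j)) ^ dz L e j| ≤
      ∏ j ∈ T, (|Lb| + |(root (L j) : ℝ)| + 1) ^ dz L e j := by
  rw [Finset.abs_prod]
  refine Finset.prod_le_prod (fun j _ => abs_nonneg _) fun j _ => ?_
  rw [abs_pow]
  refine pow_le_pow_left₀ (abs_nonneg _) ?_ _
  exact (abs_sub _ _).trans (by linarith [hy.trans (le_abs_self Lb)])

/-! ### The rational part and domination at a pole -/

/-- The rational part `R(y) = P(y)/Q(y)`. -/
def Rf (P : ℚ[X]) (L : Fin m → Atom) (e : Fin m → ℕ) (y : ℝ) : ℝ := Polynomial.aeval y P / Qf L e y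

/-- The pole hyperplanes `{y = rootⱼ}` of the genuine rows. -/
def Npol (k : ℕ) (L : Fin m → Atom) : Set (Fin (1 + k) → ℝ) :=
  {z | ∃ j, (L j).1 0 ≠ 0 ∧ z (bo k) = root (L j)}

/-- The pole hyperplanes are null. -/
theorem volume_Npol (k : ℕ) (L : Fin m → Atom) : volume (Npol k L) = 0 := by
  have : Npol k L ⊆ ⋃ j : Fin m, {z : Fin (1 + k) → ℝ | z (bo k) ∈ ({(root (L j) : ℝ)} : Set ℝ)} := by
    rintro z ⟨j, -, hj⟩; exact mem_iUnion.2 ⟨j, hj⟩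
  refine measure_mono_null this (measure_iUnion_null fun j => ?_)
  exact volume_cylinder_eq_zero (bo k) (measurableSet_singleton _) (measure_singleton _)

/-- **Domination at a pole.** If `R·LB` and `LB` are integrable on the (bounded) domain `D`, then so
is `(y − μ)^{-n} · LB` for every `n ≤ E μ − min(ρ_μ, E μ)` (`ρ_μ` the order of vanishing of the
numerator at `μ`): near `μ`, `|y − μ|^{-(E−ρ)} ≤ C |R(y)|`, elsewhere it is bounded. -/
theorem integrableOn_pole_mul_LB {D : Set (Fin (1 + k) → ℝ)} (hDm : MeasurableSet D)
    (a : Fin k → Option Atom) (P : ℚ[X]) (hP : P ≠ 0) (L : Fin m → Atom) (e : Fin m → ℕ)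
    (hrows : RowsOK L e) {Lb : ℝ} (hL : ∀ z ∈ D, ∀ j, |z j| ≤ Lb)
    (hLB : IntegrableOn (LB a) D) (hRB : IntegrableOn (fun z => Rf P L e (z (bo k)) * LB a z) D)
    (μ : ℚ) (n : ℕ) (hn : n + min (P.rootMultiplicity μ) (Emul L e μ) ≤ Emul L e μ) :
    IntegrableOn (fun z => 1 / (z (bo k) - μ) ^ n * LB a z) D := by
  classical
  rcases Nat.eq_zero_or_pos n with rfl | hn0
  · simpa using hLB
  set ρ := P.rootMultiplicity μ with hρ
  set E := Emul L e μ with hE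
  have hρE : ρ < E := by
    by_contra h; push Not at h
    rw [min_eq_right h] at hn; omega
  rw [min_eq_left hρE.le] at hn
  set E0 := E - ρ with hE0
  have hnE0 : n ≤ E0 := by omega
  -- factor the numerator at μ
  set P₂ := P /ₘ (X - C μ) ^ ρ with hP₂
  have hPfac : P = (X - C μ) ^ ρ * P₂ := (Polynomial.pow_mul_divByMonic_rootMultiplicity_eq P μ).symm
  have hP₂μ : Polynomial.aeval (μ : ℝ) P₂ ≠ 0 := by
    rw [show (μ : ℝ) = algebraMap ℚ ℝ μ from rfl, Polynomial.aeval_algebraMap_apply_eq_algebraMap_eval]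
    exact (map_ne_zero_iff _ (algebraMap ℚ ℝ).injective).2
      (Polynomial.eval_divByMonic_pow_rootMultiplicity_ne_zero μ hP)
  have hPev : ∀ y : ℝ, Polynomial.aeval y P = (y - μ) ^ ρ * Polynomial.aeval y P₂ := fun y => by
    conv_lhs => rw [hPfac]
    simp [map_mul, map_pow, map_sub]
  -- continuity of P₂ at μ
  set η := |Polynomial.aeval (μ : ℝ) P₂| / 2 with hη
  have hη0 : 0 < η := by rw [hη]; exact div_pos (abs_pos.2 hP₂μ) two_pos
  obtain ⟨δ, hδ0, hδ⟩ : ∃ δ > 0, ∀ y : ℝ, |y - μ| < δ → η ≤ |Polynomial.aeval y P₂| := by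
    have hc := (Polynomial.continuous_aeval P₂ (A := ℝ)).continuousAt (x := (μ : ℝ))
    rw [Metric.continuousAt_iff] at hc
    obtain ⟨δ, hδ0, hδ⟩ := hc η hη0
    refine ⟨δ, hδ0, fun y hy => ?_⟩
    have := hδ (by rwa [Real.dist_eq])
    rw [Real.dist_eq] at this
    have h2 : |Polynomial.aeval (μ:ℝ) P₂| = 2 * η := by rw [hη]; ring
    have := abs_sub_abs_le_abs_sub (Polynomial.aeval (μ:ℝ) P₂) (Polynomial.aeval y P₂)
    rw [abs_sub_comm] at this
    linarith
  -- the cofactor of the denominator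
  set Q₃ : ℝ → ℝ := fun y => ∏ j ∈ Finset.univ.filter (fun j => root (L j) ≠ μ),
    (y - root (L j)) ^ dz L e j with hQ₃
  set C₃ : ℝ := ∏ j ∈ Finset.univ.filter (fun j => root (L j) ≠ μ),
    (|Lb| + |(root (L j) : ℝ)| + 1) ^ dz L e j with hC₃
  have hC₃0 : 0 < C₃ := Finset.prod_pos fun j _ => pow_pos (by positivity) _
  have hκ : (kap L e : ℝ) ≠ 0 := by exact_mod_cast kap_ne_zero hrows
  -- the pointwise domination off the pole hyperplanes
  set Cst : ℝ := |(kap L e : ℝ)| * C₃ / η + 1 / δ ^ E0 with hCst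
  have hCst0 : 0 ≤ Cst := by rw [hCst]; positivity
  have hdom : ∀ z ∈ D, z ∉ Npol k L →
      1 / |z (bo k) - μ| ^ E0 ≤ Cst * (|Rf P L e (z (bo k))| + 1) := by
    intro z hz hzN
    set y := z (bo k) with hy
    have hyL : |y| ≤ Lb := hL z hz _
    have hroots : ∀ j, (L j).1 0 ≠ 0 → y ≠ root (L j) := fun j hj h => hzN ⟨j, hj, h⟩
    have hR0 : 0 ≤ |Rf P L e y| := abs_nonneg _
    by_cases hnear : |y - μ| < δ
    · -- near the pole: compare with R
      have hyμ : y - μ ≠ 0 := by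
        intro h0
        -- μ is the root of a genuine row since E μ > 0
        have hEpos : 0 < E := by omega
        obtain ⟨j, hj, hjd⟩ : ∃ j ∈ Finset.univ.filter (fun j => root (L j) = μ), dz L e j ≠ 0 := by
          by_contra h; push Not at h
          exact absurd (Finset.sum_eq_zero h) (by rw [← Emul]; exact hEpos.ne')
        have hα : (L j).1 0 ≠ 0 := by intro h; apply hjd; simp [dz, h]
        exact hroots j hα (by rw [sub_eq_zero.1 h0]; exact_mod_cast (Finset.mem_filter.1 hj).2.symm)
      have hQ₃ne : Q₃ y ≠ 0 := Finset.prod_ne_zero_iff.2 fun j _ => by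
        unfold dz; split_ifs with hα
        · simp
        · exact pow_ne_zero _ (sub_ne_zero.2 (hroots j hα))
      have hQ₃le : |Q₃ y| ≤ C₃ := abs_prod_root_le L e _ hyL
      have hRabs : |Rf P L e y| = |Polynomial.aeval y P₂| /
          (|(kap L e : ℝ)| * |Q₃ y| * |y - μ| ^ E0) := by
        have hQf : Qf L e y = (kap L e : ℝ) * ((y - μ) ^ E * Q₃ y) := by
          rw [Qf_eq, prod_root_eq L e μ]
        rw [Rf, hQf, hPev, show E = ρ + E0 by omega, pow_add]
        simp only [abs_div, abs_mul, abs_pow]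
        have hya : |y - μ| ≠ 0 := abs_ne_zero.2 hyμ
        field_simp
      have hP₂y := hδ y hnear
      have h1 : 1 / |y - μ| ^ E0 ≤ (|(kap L e : ℝ)| * C₃ / η) * |Rf P L e y| := by
        rw [hRabs]
        have hpow : 0 < |y - μ| ^ E0 := pow_pos (abs_pos.2 hyμ) _
        have hQpos : 0 < |Q₃ y| := abs_pos.2 hQ₃ne
        have hkpos : 0 < |(kap L e : ℝ)| := abs_pos.2 hκ
        rw [div_le_iff₀ hpow]
        calc (1:ℝ) = (|(kap L e : ℝ)| * |Q₃ y| / η) * (η / (|(kap L e : ℝ)| * |Q₃ y|)) := by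
              field_simp
          _ ≤ (|(kap L e : ℝ)| * C₃ / η) * (|Polynomial.aeval y P₂| / (|(kap L e : ℝ)| * |Q₃ y|)) := by
              refine mul_le_mul ?_ ?_ (by positivity) (by positivity)
              · exact div_le_div_of_nonneg_right (mul_le_mul_of_nonneg_left hQ₃le hkpos.le) hη0.le
              · exact div_le_div_of_nonneg_right hP₂y (by positivity)
          _ = (|(kap L e : ℝ)| * C₃ / η) * (|Polynomial.aeval y P₂| /
                (|(kap L e : ℝ)| * |Q₃ y| * |y - μ| ^ E0)) * |y - μ| ^ E0 := by
              field_simp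
      calc 1 / |y - μ| ^ E0 ≤ (|(kap L e : ℝ)| * C₃ / η) * |Rf P L e y| := h1
        _ ≤ Cst * (|Rf P L e y| + 1) := by
            rw [hCst]
            nlinarith [div_nonneg (zero_le_one) (pow_nonneg hδ0.le E0),
              mul_nonneg (div_nonneg (mul_nonneg (abs_nonneg (kap L e : ℝ)) hC₃0.le) hη0.le) hR0]
    · push Not at hnear
      have h1 : 1 / |y - μ| ^ E0 ≤ 1 / δ ^ E0 :=
        one_div_le_one_div_of_le (pow_pos hδ0 _) (pow_le_pow_left₀ hδ0.le hnear _)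
      calc 1 / |y - μ| ^ E0 ≤ 1 / δ ^ E0 := h1
        _ ≤ Cst * (|Rf P L e y| + 1) := by
            rw [hCst]
            nlinarith [div_nonneg (zero_le_one) (pow_nonneg hδ0.le E0),
              div_nonneg (mul_nonneg (abs_nonneg (kap L e : ℝ)) hC₃0.le) hη0.le]
  -- integrability by domination
  have hmeas : AEStronglyMeasurable (fun z : Fin (1 + k) → ℝ => 1 / (z (bo k) - μ) ^ n * LB a z)
      (volume.restrict D) :=
    ((measurable_const.div ((measurable_pi_apply _).sub_const _ |>.pow_const _)).mul
      (measurable_LB a)).aestronglyMeasurable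
  have hg : IntegrableOn (fun z => Cst * ‖Rf P L e (z (bo k)) * LB a z‖ + (Cst + 1) * ‖LB a z‖) D :=
    (hRB.norm.const_mul _).add (hLB.norm.const_mul _)
  refine Integrable.mono' hg hmeas ?_
  have hae : ∀ᵐ z ∂(volume.restrict D), z ∉ Npol k L :=
    ae_restrict_of_ae (measure_eq_zero_iff_ae_notMem.1 (volume_Npol k L))
  filter_upwards [ae_restrict_mem hDm, hae] with z hz hzN
  have hd := hdom z hz hzN
  rw [Real.norm_eq_abs, Real.norm_eq_abs, Real.norm_eq_abs, abs_mul, abs_mul, one_div, abs_inv,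
    abs_pow]
  have hLB0 := abs_nonneg (LB a z)
  have hpow := one_div_pow_le_of_le (abs_nonneg (z (bo k) - μ)) hnE0
  rw [one_div] at hpow
  calc (|z (bo k) - ↑μ| ^ n)⁻¹ * |LB a z| ≤ (1 / |z (bo k) - ↑μ| ^ E0 + 1) * |LB a z| :=
        mul_le_mul_of_nonneg_right hpow hLB0
    _ ≤ (Cst * (|Rf P L e (z (bo k))| + 1) + 1) * |LB a z| :=
        mul_le_mul_of_nonneg_right (by linarith) hLB0
    _ = Cst * (|Rf P L e (z (bo k))| * |LB a z|) + (Cst + 1) * |LB a z| := by ring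

end SepZero

/-- Registered support goal of this file: evaluation of the one-variable form of the numerator. -/
theorem separateZero_poles (p : MvPolynomial (Fin 1) ℚ) (y : ℝ) : Polynomial.aeval y (SepZero.toPoly p) = MvPolynomial.aeval (fun _ => y) p :=
  SepZero.aeval_toPoly p y

end Summit.KontsevichZagierPeriods.ArrangementNormalForm.JanusBands
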